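import Mathlib
import Literature.NumberTheory.Sieve.Maynard2016Lemma7ErrorSplit
import HarnessLib

/-!
# Maynard (2016), Lemma 7: when does a tuple `(d, d', e, e')` contribute? ((Div1)–(Div3))

Topic `Literature/NumberTheory/Sieve`; trunk AntSieve / parity (Maynard 2016 large-gaps ladder, named
fact `Literature.NumberTheory.Sieve.Maynard2016.Lemma7Tuple` of `Maynard2016Lemma7PerTuple.lean`).

J. Maynard, *Large gaps between primes*, Ann. of Math. (2) 183 (2016), 915–933 = arXiv:1408.5110,
§6, proof of Lemma 7, p. 12: "there is no contribution unless (Div1) `(d_j d'_j, d_l d'_l) = 1`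
for `j ≠ l`, (Div2) `(e_j e'_j, e_l e'_l) = 1` for `j ≠ l`, (Div3) … and in this case `q` lies in a
single residue class".  In the tree's formulation (`Maynard2016Lemma7System`, `SysSolvable` of
`Maynard2016Lemma7ErrorSplit`) the contribution of a tuple to the main term is
`mainCoeff = [SysSolvable] · #𝓘/φ(r)`; this file characterises `SysSolvable`.

PROVED here (no named facts):
* `sysSolvable_iff` — under the tuple hypotheses of `filter_system_eq_empty_or_class`:
  `SysSolvable ↔ (∀ t, (A_t, D_t) = 1) ∧ (∀ p ∣ D_{t₁}, D_{t₂} : p ∣ A_{t₂} P_{t₁} − A_{t₁} P_{t₂})`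
  (prime-by-prime compatibility, `Maynard2016QSystemRad`);
* the cross terms `A_{t₂} P_{t₁} − A_{t₁} P_{t₂}` of the system, explicitly: `cross_inl_inl`
  (`(h_{j₂} − h_{j₁}) p₀`), `cross_inr_inr` (`m (m p₀ − 1)(h_{l₂} − h_{l₁})`), `cross_inl_inr`
  (`m p₀ (h_l − h_j) + (h_j − h_i)` — the `p₀`-dependent coupling of a prime dividing both
  `[d_j,d'_j]` and `[e_l,e'_l]`, `l ≠ j`);
* the necessary conditions (Div1)–(Div3) for large `x` (every prime factor of `h_a − h_b` dividing
  `P_w`, `Maynard2016TupleArith.eventually_prime_dvd_Pw_of_dvd_hTuple_sub`):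
  `coprime_dd_of_sysSolvable` (`([d_{j₁},d'_{j₁}], [d_{j₂},d'_{j₂}]) = 1`, `j₁ ≠ j₂`),
  `coprime_ee_of_sysSolvable` (`([e_{l₁},e'_{l₁}], [e_{l₂},e'_{l₂}]) = 1`, `l₁ ≠ l₂`),
  `coprime_de_of_sysSolvable` (`([d_j,d'_j], [e_j,e'_j]) = 1`), and the coupling congruence
  `dvd_coupling_of_sysSolvable` for a prime dividing `[d_j,d'_j]` and `[e_l,e'_l]`.

## References

* J. Maynard, *Large gaps between primes*, Ann. of Math. (2) 183 (2016), 915–933; arXiv:1408.5110,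
  §6, proof of Lemma 7, (Div1)–(Div3) and display (6.28). [Maynard2016LargeGaps]
-/

open Finset

namespace Literature.NumberTheory.Sieve

namespace Maynard2016

variable {k : ℕ}

/-! ### The cross terms of the system -/

/-- `d`-side × `d`-side: `A_{j₂} P_{j₁} − A_{j₁} P_{j₂} = (h_{j₂} − h_{j₁}) p₀`. [cite: Maynard2016LargeGaps, Lemma 7 (proof, (Div1))] -/
theorem cross_inl_inl (x m p₀ : ℕ) (i j₁ j₂ : Fin k) :
    sysA k x i m (Sum.inl j₂) * sysP k m p₀ (Sum.inl j₁) -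
        sysA k x i m (Sum.inl j₁) * sysP k m p₀ (Sum.inl j₂) =
      ((hTuple k x j₂ : ℤ) - hTuple k x j₁) * p₀ := by
  simp only [sysA, sysP, Sum.elim_inl]; ring

/-- `e`-side × `e`-side: `A_{l₂} P_{l₁} − A_{l₁} P_{l₂} = m (m p₀ − 1)(h_{l₂} − h_{l₁})`. [cite: Maynard2016LargeGaps, Lemma 7 (proof, (Div2))] -/
theorem cross_inr_inr (x m p₀ : ℕ) (i l₁ l₂ : Fin k) :
    sysA k x i m (Sum.inr l₂) * sysP k m p₀ (Sum.inr l₁) -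
        sysA k x i m (Sum.inr l₁) * sysP k m p₀ (Sum.inr l₂) =
      (m : ℤ) * ((m : ℤ) * p₀ - 1) * ((hTuple k x l₂ : ℤ) - hTuple k x l₁) := by
  simp only [sysA, sysP, Sum.elim_inr]; ring

/-- `d`-side × `e`-side: `A_{l} P_{j} − A_{j} P_{l} = m p₀ (h_l − h_j) + (h_j − h_i)` — the
`p₀`-dependent coupling. [cite: Maynard2016LargeGaps, Lemma 7 (proof, (Div3))] -/
theorem cross_inl_inr (x m p₀ : ℕ) (i j l : Fin k) :
    sysA k x i m (Sum.inr l) * sysP k m p₀ (Sum.inl j) -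
        sysA k x i m (Sum.inl j) * sysP k m p₀ (Sum.inr l) =
      (m : ℤ) * p₀ * ((hTuple k x l : ℤ) - hTuple k x j) + ((hTuple k x j : ℤ) - hTuple k x i) := by
  simp only [sysA, sysP, Sum.elim_inl, Sum.elim_inr]; ring

/-- `e`-side × `d`-side (the negative of `cross_inl_inr`). [cite: Maynard2016LargeGaps, Lemma 7 (proof, (Div3))] -/
theorem cross_inr_inl (x m p₀ : ℕ) (i j l : Fin k) :
    sysA k x i m (Sum.inl j) * sysP k m p₀ (Sum.inr l) -
        sysA k x i m (Sum.inr l) * sysP k m p₀ (Sum.inl j) =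
      -((m : ℤ) * p₀ * ((hTuple k x l : ℤ) - hTuple k x j) + ((hTuple k x j : ℤ) - hTuple k x i)) := by
  simp only [sysA, sysP, Sum.elim_inl, Sum.elim_inr]; ring

/-! ### Solvability = units + prime-by-prime compatibility -/

/-- **`SysSolvable ↔` units and compatibility.**  Under the hypotheses of
`filter_system_eq_empty_or_class`: the system (6.27) has a solution `q ∈ ℕ` iff every coefficient
`A_t` is a unit modulo its modulus `D_t` and, for every prime `p` dividing two moduli `D_{t₁}, D_{t₂}`,
`p ∣ A_{t₂} P_{t₁} − A_{t₁} P_{t₂}`. [cite: Maynard2016LargeGaps, Lemma 7 (proof, (Div1)–(Div3))] -/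
theorem sysSolvable_iff {x m p₀ : ℕ} (hp₀ : p₀.Prime) {i : Fin k} {d d' e e' : Fin k → ℕ}
    (hd : ∀ j, Squarefree (d j)) (hd' : ∀ j, Squarefree (d' j)) (he : ∀ j, Squarefree (e j))
    (he' : ∀ j, Squarefree (e' j)) (hdlt : ∀ j, d j * d' j < p₀) (hei : e i = 1) (hei' : e' i = 1)
    (hacop : ∀ j, j ≠ i → IsCoprime ((m : ℤ) * p₀ - 1) ((hTuple k x j : ℤ) - hTuple k x i)) :
    SysSolvable k x m p₀ i d d' e e' ↔
      (∀ t, IsCoprime (sysA k x i m t) (sysD d d' e e' t : ℤ)) ∧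
        ∀ p : ℕ, p.Prime → ∀ t₁ t₂, p ∣ sysD d d' e e' t₁ → p ∣ sysD d d' e e' t₂ →
          (p : ℤ) ∣ sysA k x i m t₂ * sysP k m p₀ t₁ - sysA k x i m t₁ * sysP k m p₀ t₂ := by
  classical
  have hd0 : ∀ j, d j ≠ 0 := fun j => (hd j).ne_zero
  have hd0' : ∀ j, d' j ≠ 0 := fun j => (hd' j).ne_zero
  constructor
  · rintro ⟨q, hq⟩
    refine ⟨fun t => sys_unit hp₀ hd0 hd0' hdlt hei hei' hacop t (Finset.mem_univ t) q
      (hq t (Finset.mem_univ t)), fun p hp t₁ t₂ h₁ h₂ => ?_⟩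
    exact compat_of_intDvd_linear_pair ((Int.natCast_dvd_natCast.2 h₁).trans (hq t₁ (mem_univ _)))
      ((Int.natCast_dvd_natCast.2 h₂).trans (hq t₂ (mem_univ _)))
  · rintro ⟨hA, hcompat⟩
    obtain ⟨c, hc, hiff⟩ := exists_sqfSystem_iff_mod_eq (Finset.univ : Finset (Fin k ⊕ Fin k))
      (sysD d d' e e') (sysP k m p₀) (sysA k x i m) (sys_squarefree hd hd' he he')
      (fun t _ => hA t) (fun p hp t₁ _ t₂ _ h₁ h₂ => hcompat p hp t₁ t₂ h₁ h₂)
    exact ⟨c, (hiff c).2 (Nat.mod_eq_of_lt hc)⟩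

/-! ### The necessary conditions (Div1)–(Div3) -/

/-- A prime dividing `[d_j, d'_j]` (`d_j d'_j < p₀`) does not divide `p₀`. [cite: Maynard2016LargeGaps, Lemma 7 (proof, (Div1))] -/
theorem not_dvd_p₀_of_dvd_lcm {p₀ p : ℕ} (hp₀ : p₀.Prime) (hp : p.Prime) {d d' : Fin k → ℕ}
    (hd0 : ∀ j, d j ≠ 0) (hd0' : ∀ j, d' j ≠ 0) (hdlt : ∀ j, d j * d' j < p₀) {j : Fin k}
    (h : p ∣ Nat.lcm (d j) (d' j)) : ¬ p ∣ p₀ := by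
  intro hpp
  have hle : p ≤ Nat.lcm (d j) (d' j) :=
    Nat.le_of_dvd (Nat.pos_of_ne_zero (Nat.lcm_ne_zero (hd0 j) (hd0' j))) h
  have hle' : Nat.lcm (d j) (d' j) ≤ d j * d' j :=
    Nat.le_of_dvd (Nat.pos_of_ne_zero (Nat.mul_ne_zero (hd0 j) (hd0' j))) (Nat.lcm_dvd_mul _ _)
  have hpeq : p = p₀ := (Nat.prime_dvd_prime_iff_eq hp hp₀).1 hpp
  have := hdlt j
  omega

/-- Under a solution `q`: a prime `p ∣ [d_j, d'_j]` with `p ∣ P_w` would divide `p₀` (`P_w ∣ h_j, h_i`).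
[cite: Maynard2016LargeGaps, Lemma 7 (proof, (Div1))] -/
theorem dvd_p₀_of_dvd_lcm_of_dvd_Pw {x m p₀ p : ℕ} {i j : Fin k} {d d' e e' : Fin k → ℕ} {q : ℕ}
    (hq : ∀ t ∈ (Finset.univ : Finset (Fin k ⊕ Fin k)),
      (sysD d d' e e' t : ℤ) ∣ sysP k m p₀ t + sysA k x i m t * q)
    (h : p ∣ Nat.lcm (d j) (d' j)) (hPw : p ∣ Pw x) : (p : ℤ) ∣ p₀ := by
  have h1 := hq (Sum.inl j) (Finset.mem_univ _)
  simp only [sysD, sysP, sysA, Sum.elim_inl] at h1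
  have h2 : (p : ℤ) ∣ (p₀ : ℤ) + ((hTuple k x j : ℤ) - hTuple k x i) * q :=
    (Int.natCast_dvd_natCast.2 h).trans h1
  have h3 : (p : ℤ) ∣ ((hTuple k x j : ℤ) - hTuple k x i) * q :=
    Dvd.dvd.mul_right ((Int.natCast_dvd_natCast.2 (hPw.trans (Pw_dvd_hTuple k x j))).sub
      (Int.natCast_dvd_natCast.2 (hPw.trans (Pw_dvd_hTuple k x i)))) _
  exact (dvd_add_left h3).1 h2

/-- **(Div1)** For large `x` (every prime factor of `h_a − h_b`, `a ≠ b`, divides `P_w`): if the system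
is solvable then `([d_{j₁},d'_{j₁}], [d_{j₂},d'_{j₂}]) = 1` for `j₁ ≠ j₂`. [cite: Maynard2016LargeGaps, Lemma 7 (proof, (Div1))] -/
theorem coprime_dd_of_sysSolvable {x m p₀ : ℕ} (hp₀ : p₀.Prime)
    (hW : ∀ a b : Fin k, a ≠ b → ∀ p : ℕ, p.Prime →
      (p : ℤ) ∣ (hTuple k x b : ℤ) - hTuple k x a → p ∣ Pw x)
    {i : Fin k} {d d' e e' : Fin k → ℕ} (hd0 : ∀ j, d j ≠ 0) (hd0' : ∀ j, d' j ≠ 0)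
    (hdlt : ∀ j, d j * d' j < p₀) (hsol : SysSolvable k x m p₀ i d d' e e') {j₁ j₂ : Fin k}
    (hne : j₁ ≠ j₂) : Nat.Coprime (Nat.lcm (d j₁) (d' j₁)) (Nat.lcm (d j₂) (d' j₂)) := by
  obtain ⟨q, hq⟩ := hsol
  by_contra hnc
  obtain ⟨p, hp, h₁, h₂⟩ := Nat.Prime.not_coprime_iff_dvd.1 hnc
  have hnot := not_dvd_p₀_of_dvd_lcm hp₀ hp hd0 hd0' hdlt h₁
  have hc := compat_of_intDvd_linear_pair
    ((Int.natCast_dvd_natCast.2 h₁).trans (hq (Sum.inl j₁) (mem_univ _)))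
    ((Int.natCast_dvd_natCast.2 h₂).trans (hq (Sum.inl j₂) (mem_univ _)))
  rw [cross_inl_inl] at hc
  have hpZ : Prime (p : ℤ) := Nat.prime_iff_prime_int.mp hp
  rcases hpZ.dvd_or_dvd hc with h3 | h3
  · -- `p ∣ h_{j₂} − h_{j₁}`, so `p ∣ P_w`, so `p ∣ p₀`
    exact hnot (Int.natCast_dvd_natCast.1 (dvd_p₀_of_dvd_lcm_of_dvd_Pw hq h₁ (hW j₁ j₂ hne p hp h3)))
  · exact hnot (Int.natCast_dvd_natCast.1 h3)

/-- **(Div2)** For large `x`: if the system is solvable then `([e_{l₁},e'_{l₁}], [e_{l₂},e'_{l₂}]) = 1`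
for `l₁ ≠ l₂` (`m ≥ 1`, `(m p₀ − 1, e_l e'_l) = 1`). [cite: Maynard2016LargeGaps, Lemma 7 (proof, (Div2))] -/
theorem coprime_ee_of_sysSolvable {x m p₀ : ℕ} (hm : 1 ≤ m)
    (hW : ∀ a b : Fin k, a ≠ b → ∀ p : ℕ, p.Prime →
      (p : ℤ) ∣ (hTuple k x b : ℤ) - hTuple k x a → p ∣ Pw x)
    {i : Fin k} {d d' e e' : Fin k → ℕ} (hecop : ∀ j, Nat.Coprime (m * p₀ - 1) (e j * e' j))
    (hsol : SysSolvable k x m p₀ i d d' e e') {l₁ l₂ : Fin k} (hne : l₁ ≠ l₂) : Nat.Coprime (Nat.lcm (e l₁) (e' l₁)) (Nat.lcm (e l₂) (e' l₂)) := by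
  obtain ⟨q, hq⟩ := hsol
  by_contra hnc
  obtain ⟨p, hp, h₁, h₂⟩ := Nat.Prime.not_coprime_iff_dvd.1 hnc
  have hpZ : Prime (p : ℤ) := Nat.prime_iff_prime_int.mp hp
  have hmp : ((m * p₀ - 1 : ℕ) : ℤ) = (m : ℤ) * p₀ - 1 := by
    have h1 : 1 ≤ m * p₀ := by
      rcases Nat.eq_zero_or_pos p₀ with h0 | h0
      · -- `p₀ = 0`: then `m p₀ − 1 = 0` is coprime to `e_l e'_l` only if `e_l e'_l = 1`
        exfalso
        have := hecop l₁
        rw [h0, Nat.mul_zero, Nat.zero_sub, Nat.coprime_zero_left] at this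
        have hE : Nat.lcm (e l₁) (e' l₁) = 1 := by
          rw [mul_eq_one] at this; rw [this.1, this.2, Nat.lcm_one_left]
        rw [hE] at h₁
        exact hp.one_lt.ne' (Nat.dvd_one.1 h₁)
      · exact Nat.one_le_iff_ne_zero.2 (Nat.mul_ne_zero (by omega) h0.ne')
    push_cast [Nat.cast_sub h1]; ring
  -- `p ∤ m p₀ − 1` (from `(m p₀ − 1, e_{l₁} e'_{l₁}) = 1`)
  have hP : ¬ (p : ℤ) ∣ (m : ℤ) * p₀ - 1 := by
    rw [← hmp, Int.natCast_dvd_natCast]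
    intro h
    have h' : p ∣ e l₁ * e' l₁ := h₁.trans (Nat.lcm_dvd_mul _ _)
    exact hp.one_lt.ne' (Nat.dvd_one.1 (by
      have := Nat.dvd_gcd h h'; rwa [(hecop l₁)] at this))
  -- the `l₁`-condition: `p ∣ (m p₀ − 1) + m (h_{l₁} − h_i) q`
  have hl₁ := hq (Sum.inr l₁) (Finset.mem_univ _)
  simp only [sysD, sysP, sysA, Sum.elim_inr] at hl₁
  have hl₁' : (p : ℤ) ∣ (m : ℤ) * p₀ - 1 + (m : ℤ) * ((hTuple k x l₁ : ℤ) - hTuple k x i) * q :=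
    (Int.natCast_dvd_natCast.2 h₁).trans hl₁
  -- `p ∤ m`
  have hpm : ¬ (p : ℤ) ∣ (m : ℤ) := by
    intro h
    apply hP
    have h3 : (p : ℤ) ∣ (m : ℤ) * ((hTuple k x l₁ : ℤ) - hTuple k x i) * q :=
      (h.mul_right _).mul_right _
    exact (dvd_add_left h3).1 hl₁'
  have hc := compat_of_intDvd_linear_pair
    ((Int.natCast_dvd_natCast.2 h₁).trans (hq (Sum.inr l₁) (mem_univ _)))
    ((Int.natCast_dvd_natCast.2 h₂).trans (hq (Sum.inr l₂) (mem_univ _)))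
  rw [cross_inr_inr] at hc
  rcases hpZ.dvd_or_dvd hc with h3 | h3
  · rcases hpZ.dvd_or_dvd h3 with h4 | h4
    · exact hpm h4
    · exact hP h4
  · -- `p ∣ h_{l₂} − h_{l₁}`: then `p ∣ P_w ∣ h_{l₁}, h_i`, so `p ∣ m p₀ − 1`
    have hPw := hW l₁ l₂ hne p hp h3
    apply hP
    have h4 : (p : ℤ) ∣ (m : ℤ) * ((hTuple k x l₁ : ℤ) - hTuple k x i) * q :=
      ((((Int.natCast_dvd_natCast.2 (hPw.trans (Pw_dvd_hTuple k x l₁))).sub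
        (Int.natCast_dvd_natCast.2 (hPw.trans (Pw_dvd_hTuple k x i)))).mul_left _).mul_right _)
    exact (dvd_add_left h4).1 hl₁'

/-- **(Div3), diagonal part** For large `x`: if the system is solvable then `([d_j,d'_j], [e_j,e'_j]) = 1`
for every `j`. [cite: Maynard2016LargeGaps, Lemma 7 (proof, (Div3))] -/
theorem coprime_de_of_sysSolvable {x m p₀ : ℕ} (hp₀ : p₀.Prime)
    (hW : ∀ a b : Fin k, a ≠ b → ∀ p : ℕ, p.Prime →
      (p : ℤ) ∣ (hTuple k x b : ℤ) - hTuple k x a → p ∣ Pw x)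
    {i : Fin k} {d d' e e' : Fin k → ℕ} (hd0 : ∀ j, d j ≠ 0) (hd0' : ∀ j, d' j ≠ 0)
    (hdlt : ∀ j, d j * d' j < p₀) (hsol : SysSolvable k x m p₀ i d d' e e') (j : Fin k) :
    Nat.Coprime (Nat.lcm (d j) (d' j)) (Nat.lcm (e j) (e' j)) := by
  obtain ⟨q, hq⟩ := hsol
  by_contra hnc
  obtain ⟨p, hp, h₁, h₂⟩ := Nat.Prime.not_coprime_iff_dvd.1 hnc
  have hnot := not_dvd_p₀_of_dvd_lcm hp₀ hp hd0 hd0' hdlt h₁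
  have hpZ : Prime (p : ℤ) := Nat.prime_iff_prime_int.mp hp
  have hc := compat_of_intDvd_linear_pair
    ((Int.natCast_dvd_natCast.2 h₁).trans (hq (Sum.inl j) (mem_univ _)))
    ((Int.natCast_dvd_natCast.2 h₂).trans (hq (Sum.inr j) (mem_univ _)))
  rw [cross_inl_inr, sub_self, mul_zero, zero_add] at hc
  -- `p ∣ h_j − h_i`
  by_cases hji : j = i
  · subst hji
    have h1 := hq (Sum.inl j) (Finset.mem_univ _)
    simp only [sysD, sysP, sysA, Sum.elim_inl, sub_self, zero_mul, add_zero] at h1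
    exact hnot (Int.natCast_dvd_natCast.1 ((Int.natCast_dvd_natCast.2 h₁).trans h1))
  · exact hnot (Int.natCast_dvd_natCast.1
      (dvd_p₀_of_dvd_lcm_of_dvd_Pw hq h₁ (hW i j (Ne.symm hji) p hp hc)))

/-- **(Div3), coupling part** If the system is solvable and a prime `p` divides both `[d_j,d'_j]` and
`[e_l,e'_l]`, then `p ∣ m p₀ (h_l − h_j) + (h_j − h_i)` (a congruence condition on `p₀ (mod p)`).
[cite: Maynard2016LargeGaps, Lemma 7 (proof, (Div3))] -/
theorem dvd_coupling_of_sysSolvable {x m p₀ : ℕ} {i : Fin k} {d d' e e' : Fin k → ℕ}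
    (hsol : SysSolvable k x m p₀ i d d' e e') {p : ℕ} {j l : Fin k}
    (h₁ : p ∣ Nat.lcm (d j) (d' j)) (h₂ : p ∣ Nat.lcm (e l) (e' l)) :
    (p : ℤ) ∣ (m : ℤ) * p₀ * ((hTuple k x l : ℤ) - hTuple k x j) +
      ((hTuple k x j : ℤ) - hTuple k x i) := by
  obtain ⟨q, hq⟩ := hsol
  have hc := compat_of_intDvd_linear_pair
    ((Int.natCast_dvd_natCast.2 h₁).trans (hq (Sum.inl j) (mem_univ _)))
    ((Int.natCast_dvd_natCast.2 h₂).trans (hq (Sum.inr l) (mem_univ _)))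
  rwa [cross_inl_inr] at hc

end Maynard2016

end Literature.NumberTheory.Sieve
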